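import Mathlib
import Summits.ResolutionOfSingularities.ResolutionOfSingularities.Theorems.HomologicalConductorPersistenceGradedTransferPairing
import Summits.ResolutionOfSingularities.ResolutionOfSingularities.Theorems.HomologicalConductorPersistenceCyclicTransferAbelianCeiling
import HarnessLib

/-!
# Rung S-2 `PersistenceSurface` (stmt-ResolutionOfSingularities-19970) — the REYNOLDS-FREE TRANSFER, part 4: the
# RANK-ONE CEILING `ca³(V₀) ⊆ ⋂ₓ V_x · V_{−x}` from a finite GRADING, and AUSLANDER'S LAW in every characteristic
# (stub-4's part 12 without characters; res-L1-w44b-stub-1 gen 6, cell C2 / K-PCC F5–F6)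

Route `ResolutionOfSingularities/HomologicalConductor`, chain W4.4b (cell res-hironaka).  `[OURS · L1 w44b]` replaces
the role of no printed item; NOT a statement of the manuscript under review (Hironaka 2017), nothing here is
attributed to its author; folklore algebra, AI-written (weaker than expert review).

## Content

Setting of part 3 (`…GradedTransferPairing`): `V` a noetherian NORMAL DOMAIN finitely graded over `U = V₀` by
`U`-linear projectors `eₓ` (`x ∈ G` finite), `e₀ 1 = 1`, `V₀ = algebraMap(U)` (`ρ`), `algebraMap` injective, (BIG).

* `moduleFinite_of_graded` — `V` is MODULE-FINITE over `U`: generators of the ideal `V·V_x` lying in `V_x` generate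
  `V_x` over `V₀` (shift lemma) — removes the `Module.Finite U V` hypothesis of stub-4's parts 11–13.
* **`exists_graded_decomposition_of_mem_cohomologyAnnihilatorOfDegree_three`** — THE CEILING: `U` noetherian,
  `u ∈ ca³(U)`, `V_x ≠ 0` ⇒ `algebraMap u = ∑ₖ bₖ b′ₖ` with `bₖ ∈ V_x`, `b′ₖ ∈ V_{−x}`.  Proof = stub-4's part 12 with
  the projector `|G|⁻¹ P_χ` replaced by `eₓ` (no division): `V|_U ≅ Hom_U(V,U)` (perfect pairing, part 3) is a second
  syzygy (`exists_isSyzygy_two_dual`), `V_x` is a `U`-retract of it, so `u` stably annihilates `V_x`; in a free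
  factorisation `u·id = ∑ gᵢ fᵢ` each `fᵢ ∘ eₓ` is multiplication by `yᵢ ∈ V_{−x}` (`exists_eq_mul_of_degree`), whence
  `u m = m ∑ yᵢ nᵢ` on `V_x`; cancel `m ≠ 0`.
* **`mem_cohomologyAnnihilatorOfDegree_three_iff_of_graded`** — AUSLANDER'S LAW at level `ca³` for graded covers
  with `ca³(V) = V` and all pieces nonzero: `u ∈ ca³(U) ⟺ algebraMap u ∈ ⋂ₓ V_x·V_{−x}` — EVERY characteristic.

References (mechanism only): S. B. Iyengar, R. Takahashi, IMRN 2016, arXiv:1404.1476, Remark 2.13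
[`IyengarTakahashi2014`]; M. Auslander, Trans. AMS 293 (1986) (`MCM(S^G) = add S`); folklore.
-/

noncomputable section

-- single-problem summit: the doubled namespace component `ResolutionOfSingularities` is forced
set_option linter.dupNamespace false

namespace Summit.ResolutionOfSingularities.ResolutionOfSingularities.Theorems.HomologicalConductor.PersistenceGradedTransfer

open Finset CategoryTheory Literature.RingTheory.CohomologyAnnihilator
open Summit.ResolutionOfSingularities.ResolutionOfSingularities.Theorems.NoZeno.SandwichCluster
open Summit.ResolutionOfSingularities.ResolutionOfSingularities.Theorems.HomologicalConductor.PersistenceSurfaceHullCover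
open Summit.ResolutionOfSingularities.ResolutionOfSingularities.Theorems.HomologicalConductor.PersistenceCyclicTransferAbelianCeiling

universe u

variable {U V : Type u} [CommRing U] [CommRing V] [Algebra U V]
variable {G : Type*} [AddCommGroup G] [Fintype G] [DecidableEq G]

/-! ## Graded covers are module-finite -/

/-- **A finitely graded noetherian ring is module-finite over its degree-`0` part**: if the ideal `V·V_x` is
generated by `s₁,…,s_r ∈ V_x`, then `V_x = ∑ V₀ sᵢ` (`eₓ(sᵢ v) = sᵢ e₀(v)`), and `V = ⊕ₓ V_x`. [folklore] -/
theorem moduleFinite_of_graded [IsNoetherianRing V] (e : G → (V →ₗ[U] V)) (he_sum : ∀ w, ∑ x, e x w = w)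
    (he_proj : ∀ x y w, e x (e y w) = if x = y then e y w else 0)
    (he_mul : ∀ x y (v w : V), e x v = v → e y w = w → e (x + y) (v * w) = v * w)
    (ρ : V →ₗ[U] U) (hρ : ∀ v, algebraMap U V (ρ v) = e 0 v) : Module.Finite U V := by
  classical
  have hS : ∀ x : G, ∃ S : Finset V, ∀ m, e x m = m → m ∈ Submodule.span U (S : Set V) := by
    intro x
    let T : Set V := {m | e x m = m}
    have hfg : (Submodule.span V T).FG := IsNoetherian.noetherian _
    obtain ⟨S, hST, hspan⟩ := (Submodule.fg_span_iff_fg_span_finset_subset T).mp hfg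
    refine ⟨S, fun m hm => ?_⟩
    have hmT : m ∈ Submodule.span V T := Submodule.subset_span hm
    rw [hspan] at hmT
    obtain ⟨f, -, hf⟩ := Submodule.mem_span_finset.mp hmT
    rw [← hm, ← hf, map_sum]
    refine Submodule.sum_mem _ fun a ha => ?_
    have hadeg : e x a = a := hST ha
    have : e x (f a • a) = ρ (f a) • a := by
      rw [smul_eq_mul, mul_comm, proj_mul_eq_of_graded e he_sum he_proj he_mul hadeg x (f a), sub_self,
        Algebra.smul_def, hρ, mul_comm]
    rw [this]
    exact Submodule.smul_mem _ _ (Submodule.subset_span ha)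
  choose S hS using hS
  refine ⟨⟨Finset.univ.biUnion S, ?_⟩⟩
  rw [eq_top_iff]
  rintro v -
  rw [← he_sum v]
  refine Submodule.sum_mem _ fun x _ => ?_
  have hx := hS x (e x v) (by rw [he_proj, if_pos rfl])
  exact Submodule.span_mono (Finset.coe_subset.mpr (Finset.subset_biUnion_of_mem S (Finset.mem_univ x))) hx

/-! ## The ceiling -/

section Normal

variable [IsDomain V] [IsNoetherianRing V] [IsIntegrallyClosed V]

/-- **RANK-ONE CEILING from a grading: `ca³(V₀) ⊆ ⋂ₓ V_x · V_{−x}`.**  `U` noetherian, `V` a noetherian normal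
domain finitely graded over `U = V₀` (`e₀ 1 = 1`, `V₀ = algebraMap U`, `algebraMap` injective) with (BIG).  Then
every `u ∈ ca³(U)` decomposes, for every `x` with `V_x ≠ 0`, as `algebraMap u = ∑ₖ bₖ b′ₖ` with `bₖ ∈ V_x`,
`b′ₖ ∈ V_{−x}` — with NO `|G| ∈ Uˣ` and no group action (stub-4's part 12 for gradings). [this work]
(mechanism: Auslander 1986 / Iyengar–Takahashi 2016, folklore) -/
theorem exists_graded_decomposition_of_mem_cohomologyAnnihilatorOfDegree_three [IsNoetherianRing U]
    (e : G → (V →ₗ[U] V)) (he_sum : ∀ w, ∑ x, e x w = w)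
    (he_proj : ∀ x y w, e x (e y w) = if x = y then e y w else 0)
    (he_mul : ∀ x y (v w : V), e x v = v → e y w = w → e (x + y) (v * w) = v * w) (he_one : e 0 1 = 1)
    (he_zero : ∀ v, e 0 v = v → ∃ r : U, algebraMap U V r = v) (hinj : Function.Injective (algebraMap U V))
    (hbig : ∀ (x : G) (P : Ideal V), P.IsPrime → P.height = 1 → ∃ m : V, e x m = m ∧ m ∉ P)
    (ρ : V →ₗ[U] U) (hρ : ∀ v, algebraMap U V (ρ v) = e 0 v)
    {u : U} (hu : u ∈ cohomologyAnnihilatorOfDegree U 3) (x : G) (hx : ∃ m : V, e x m = m ∧ m ≠ 0) :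
    ∃ (n : ℕ) (b b' : Fin n → V), (∀ k, e x (b k) = b k) ∧ (∀ k, e (-x) (b' k) = b' k) ∧
      ∑ k, b k * b' k = algebraMap U V u := by
  classical
  haveI : Module.Finite U V := moduleFinite_of_graded e he_sum he_proj he_mul ρ hρ
  have hex : ∀ v, e x (e x v) = e x v := fun v => by rw [he_proj, if_pos rfl]
  -- the graded piece `M_x ⊆ V` as a `U`-submodule, with the `U`-linear projector `π = eₓ`
  let Mx : Submodule U V := LinearMap.eqLocus (e x) LinearMap.id
  have hMx : ∀ v : V, v ∈ Mx ↔ e x v = v := fun v => LinearMap.mem_eqLocus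
  let π : V →ₗ[U] Mx := LinearMap.codRestrict Mx (e x) fun v => (hMx _).mpr (hex v)
  have hπM : ∀ m : Mx, π (m : V) = m := fun m => Subtype.ext (show e x (m : V) = m from (hMx _).mp m.2)
  -- (1)+(2): `V|_U ≅ Hom_U(V,U)` (perfect pairing) is a second syzygy; `M_x` is a retract of it
  let W := (ModuleCat.restrictScalars (algebraMap U V)).obj (ModuleCat.of V V)
  let toW : V → W := fun v => v
  let ofW : W → V := fun w => w
  have hpair := pairing_existsUnique_of_graded e he_sum he_proj he_mul he_one he_zero hinj hbig ρ hρ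
  let pr : V →ₗ[U] (W →ₗ[U] U) :=
    { toFun := fun w =>
        { toFun := fun v => ρ (ofW v * w)
          map_add' := fun v v' => by
            change ρ ((ofW v + ofW v') * w) = _
            rw [add_mul, map_add]
          map_smul' := fun c v => by
            change ρ ((algebraMap U V c * ofW v) * w) = c • ρ (ofW v * w)
            rw [mul_assoc, ← Algebra.smul_def, map_smul] }
      map_add' := fun w w' => by
        apply LinearMap.ext
        intro v
        change ρ (ofW v * (w + w')) = ρ (ofW v * w) + ρ (ofW v * w')
        rw [mul_add, map_add]
      map_smul' := fun c w => by
        apply LinearMap.ext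
        intro v
        change ρ (ofW v * (c • w)) = c • ρ (ofW v * w)
        rw [Algebra.smul_def, mul_left_comm, ← Algebra.smul_def, map_smul] }
  have hpr : ∀ w (v : V), pr w (toW v) = ρ (v * w) := fun _ _ => rfl
  have hpr_bij : Function.Bijective pr := by
    constructor
    · intro w w' h
      obtain ⟨w₀, -, huniq⟩ := hpair (pr w)
      have e1 : w = w₀ := huniq w (fun v => (hpr w v).symm)
      have e2 : w' = w₀ := huniq w' (fun v => by rw [h]; exact (hpr w' v).symm)
      rw [e1, e2]
    · intro φ
      obtain ⟨w₀, hw₀, -⟩ := hpair φ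
      exact ⟨w₀, LinearMap.ext fun v => (hw₀ (ofW v)).symm⟩
  let epr : V ≃ₗ[U] (W →ₗ[U] U) := LinearEquiv.ofBijective pr hpr_bij
  haveI : Module.Finite U W := by
    let tW : V →ₗ[U] W :=
      { toFun := toW
        map_add' := fun _ _ => rfl
        map_smul' := fun c v => by
          change toW (c • v) = toW (algebraMap U V c * v)
          rw [Algebra.smul_def] }
    exact Module.Finite.of_surjective tW fun w => ⟨ofW w, rfl⟩
  obtain ⟨X, K, hX, hK, ⟨eK⟩⟩ := exists_isSyzygy_two_dual (U := U) W
  have hsK : StablyAnnihilates U u K :=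
    (mem_cohomologyAnnihilatorOfDegree_succ_iff_forall_isSyzygy u).mp hu X K hX hK
  have hsM : StablyAnnihilates U u (ModuleCat.of U Mx) := by
    refine stablyAnnihilates_of_retract (K := K) (M := Mx)
      (eK.toLinearMap ∘ₗ epr.toLinearMap ∘ₗ Mx.subtype) (π ∘ₗ epr.symm.toLinearMap ∘ₗ eK.symm.toLinearMap)
      (fun m => ?_) hsK
    simp only [LinearMap.comp_apply, LinearEquiv.coe_toLinearMap, LinearEquiv.symm_apply_apply,
      Submodule.subtype_apply]
    exact hπM m
  -- (3) a free factorisation of `u • id` on `M_x`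
  obtain ⟨s, f, gmap, hgf⟩ := (stablyAnnihilates_iff_exists_linearMap u (ModuleCat.of U Mx)).mp hsM
  -- the components `fᵢ ∘ eₓ : V → U` are multiplications by `yᵢ ∈ V_{−x}` on `V_x`
  have hext : ∀ i : Fin s, ∃ y : V, e (-x) y = y ∧ ∀ m : Mx, algebraMap U V (f m i) = (m : V) * y := by
    intro i
    let φ : W →ₗ[U] U :=
      { toFun := fun v => f (π (ofW v)) i
        map_add' := fun v w => by
          change f (π (ofW v + ofW w)) i = f (π (ofW v)) i + f (π (ofW w)) i
          rw [map_add, map_add, Pi.add_apply]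
        map_smul' := fun c v => by
          change f (π (algebraMap U V c * ofW v)) i = c • f (π (ofW v)) i
          rw [← Algebra.smul_def, map_smul, map_smul, Pi.smul_apply] }
    obtain ⟨y, hy, hymul⟩ := exists_eq_mul_of_degree e he_sum he_proj he_mul he_one he_zero x (hbig x) φ
    refine ⟨y, hy, fun m => ?_⟩
    have h1 := hymul (m : V) ((hMx _).mp m.2)
    have h2 : φ (toW (m : V)) = f (π (m : V)) i := rfl
    rw [← h1]
    change algebraMap U V (f m i) = algebraMap U V (φ (toW (m : V)))
    rw [h2, hπM]
  choose y hy hymul using hext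
  -- the elements `nᵢ = g(eᵢ) ∈ M_x`
  let nn : Fin s → V := fun i => (gmap (Pi.single i 1) : V)
  have hnn : ∀ i, e x (nn i) = nn i := fun i => (hMx _).mp (gmap (Pi.single i 1)).2
  -- `u m = m ∑ yᵢ nᵢ` on `M_x`
  have hkey : ∀ m : Mx, algebraMap U V u * (m : V) = (m : V) * ∑ i, y i * nn i := by
    intro m
    have e1 : gmap (f m) = u • m := LinearMap.congr_fun hgf m
    have e2 : f m = ∑ i, f m i • Pi.single i (1 : U) := by
      ext j
      simp [Finset.sum_apply, Pi.single_apply]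
    have e3 : (u • m : Mx) = ∑ i, f m i • gmap (Pi.single i 1) := by
      rw [← e1]
      conv_lhs => rw [e2]
      rw [map_sum]
      exact Finset.sum_congr rfl fun i _ => by rw [map_smul]
    have e4 : algebraMap U V u * (m : V) = ∑ i, algebraMap U V (f m i) * nn i := by
      have := congrArg Mx.subtype e3
      rw [map_smul, map_sum] at this
      simp only [Submodule.subtype_apply, map_smul, Algebra.smul_def] at this
      exact this
    rw [e4, Finset.mul_sum]
    refine Finset.sum_congr rfl fun i _ => ?_
    rw [hymul i m]
    ring
  -- cancel a nonzero element of `M_x`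
  obtain ⟨m₀, hm₀, hm₀ne⟩ := hx
  have hk : algebraMap U V u * m₀ = m₀ * ∑ i, y i * nn i := hkey ⟨m₀, (hMx _).mpr hm₀⟩
  have hcancel : algebraMap U V u = ∑ i, y i * nn i := by
    have : m₀ * (algebraMap U V u - ∑ i, y i * nn i) = 0 := by rw [mul_sub, sub_eq_zero, ← hk]; ring
    exact sub_eq_zero.mp ((mul_eq_zero.mp this).resolve_left hm₀ne)
  refine ⟨s, nn, y, hnn, hy, ?_⟩
  rw [hcancel]
  exact Finset.sum_congr rfl fun i _ => mul_comm _ _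

/-- **AUSLANDER'S LAW at level `ca³` for GRADED covers, every characteristic.**  If moreover `ca³(V) = V` (e.g.
`V = k[u,v]`) and every graded piece is nonzero, then `u ∈ ca³(U) ⟺ algebraMap u ∈ ⋂ₓ V_x·V_{−x}`: FLOOR (part 3,
`c = 1`) = CEILING (above).  No `|G| ∈ Uˣ`, no root of unity, no group. [this work] -/
theorem mem_cohomologyAnnihilatorOfDegree_three_iff_of_graded [IsNoetherianRing U] (e : G → (V →ₗ[U] V))
    (he_sum : ∀ w, ∑ x, e x w = w) (he_proj : ∀ x y w, e x (e y w) = if x = y then e y w else 0)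
    (he_mul : ∀ x y (v w : V), e x v = v → e y w = w → e (x + y) (v * w) = v * w) (he_one : e 0 1 = 1)
    (he_zero : ∀ v, e 0 v = v → ∃ r : U, algebraMap U V r = v) (hinj : Function.Injective (algebraMap U V))
    (hbig : ∀ (x : G) (P : Ideal V), P.IsPrime → P.height = 1 → ∃ m : V, e x m = m ∧ m ∉ P)
    (ρ : V →ₗ[U] U) (hρ : ∀ v, algebraMap U V (ρ v) = e 0 v) (hV : cohomologyAnnihilatorOfDegree V 3 = ⊤)
    (hne : ∀ x : G, ∃ m : V, e x m = m ∧ m ≠ 0) (u : U) :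
    u ∈ cohomologyAnnihilatorOfDegree U 3 ↔
      ∀ x : G, ∃ (n : ℕ) (b b' : Fin n → V), (∀ k, e x (b k) = b k) ∧ (∀ k, e (-x) (b' k) = b' k) ∧
        ∑ k, b k * b' k = algebraMap U V u := by
  constructor
  · intro hu x
    exact exists_graded_decomposition_of_mem_cohomologyAnnihilatorOfDegree_three e he_sum he_proj he_mul he_one
      he_zero hinj hbig ρ hρ hu x (hne x)
  · intro h
    choose n b b' hb hb' hsum using h
    exact mul_mem_cohomologyAnnihilatorOfDegree_three_of_graded e he_sum he_proj he_mul he_one he_zero hinj hbig ρ hρ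
      (c := 1) (by rw [hV]; exact Submodule.mem_top) n b b' hb' hsum u (by rw [mul_one])

end Normal

end Summit.ResolutionOfSingularities.ResolutionOfSingularities.Theorems.HomologicalConductor.PersistenceGradedTransfer

end
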